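import Summits.CriticalPhenomena.SAWScalingLimit.Theorems.SAWDevelopingMapObservableToSLEFloorPart
import Literature.Probability.RandomPlanarGeometry.HexDomainSingleton
import Literature.Probability.Percolation.TriLoopWinding
import HarnessLib

/-!
# Crux `SAWDevelopingMap.ObservableToSLE` (stmt-CriticalPhenomena-10472): the W2 stubs of the two SIBLING lines
imply the crux modulo the two estimates

Landing target:
`Summits/CriticalPhenomena/SAWScalingLimit/Theorems/SAWDevelopingMapObservableToSLESiblingResidue.lean`
(`--supports stmt-CriticalPhenomena-10472`; continuation lead prover-line-stmt-CriticalPhenomena-10472-c2-0).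

The lines `source-residue-restriction-pinning` and `coalescent-arc-restriction` end in extension stubs
(`stub_domainEndpointUniversality`, `stub_extension`) whose premise classes — CONVEX Dobrushin domains with both
marked points on `ℝ` and flat half-discs there, resp. `FlatOnLine ∧ Convex`, with bottom-row endpoints — are
SUBCLASSES of the floor class of line floor-ratio.  Two elementary facts make this precise
(`subset_upper_of_convex_flat`: a convex open set flat above a boundary point lies above the horizontal line
through it; `exists_floor_neighbour_of_bottomRow`: a row-`0` up-vertex has a honeycomb neighbour below the real
axis), and with the landed floor part (`stub_floorObservableToSLE_of_estimates`, p114707) each sibling W2 stub then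
yields the crux BY NAME modulo half-plane arch tightness (HPAT) and the uniform injectivity modulus (UIM):
`stub_observableToSLE_of_sourceResidueExtension_of_estimates`, `stub_observableToSLE_of_coalescentArcExtension_of_estimates`.
So the two sibling W2 stubs are at least as strong as floor-ratio's dead `stub_domainExtension` modulo the
estimates (`stub_domainExtension_iff_observableToSLE_of_estimates`, p116305): all three lines die at one typed point.
-/

noncomputable section

open scoped BigOperators Topology NNReal ENNReal Classical
open Filter Set MeasureTheory Metric
open Literature.Probability.LatticeModels (HexVertex hexGraph hexCenter Site)
open Literature.Probability.RandomPlanarGeometry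
open Literature.Probability.RandomPlanarGeometry.SAW
open UpperHalfPlane (upperHalfPlaneSet)

namespace Summit.CriticalPhenomena.SAWScalingLimit.Theorems.ObservableToSLE.FloorRatio

open Summit.CriticalPhenomena.SAWScalingLimit.Theses.SAWDevelopingMap
  (HexObservableLimit HexTight ObservableToSLE)
open Summit.CriticalPhenomena.SAWScalingLimit.Theorems.ObservableToSLE.Negative
  (observableToSLE_iff_identification convergesInLawToSLE_of_identification)

/-! ## Two elementary facts -/

/-- **A convex open set which is the open upper half-disc near a point `a` lies above the horizontal line
through `a`.**  If `z ∈ Ω` had `im z ≤ im a`, push it slightly down inside the open set `Ω` if necessary, then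
the segment from `a + is ∈ Ω` (`s` small) to `z` crosses the line `im = im a` inside `B(a, ρ)`, where `Ω` has no
such points. [folklore] -/
theorem subset_upper_of_convex_flat {Ω : Set ℂ} (hΩ : IsOpen Ω) (hconv : Convex ℝ Ω) {a : ℂ} {ρ : ℝ}
    (hρ : 0 < ρ) (hflat : Ω ∩ ball a ρ = {z : ℂ | a.im < z.im} ∩ ball a ρ) :
    Ω ⊆ {z : ℂ | a.im < z.im} := by
  intro z hz
  by_contra hzle
  simp only [mem_setOf_eq, not_lt] at hzle
  -- Step 1: a point of `Ω` strictly below the line.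
  obtain ⟨z', hz', hlt⟩ : ∃ z' ∈ Ω, z'.im < a.im := by
    rcases hzle.lt_or_eq with hlt | heq
    · exact ⟨z, hz, hlt⟩
    · obtain ⟨ε, hε, hball⟩ := Metric.isOpen_iff.mp hΩ z hz
      refine ⟨z - ((ε / 2 : ℝ) : ℂ) * Complex.I, hball ?_, ?_⟩
      · rw [Metric.mem_ball, dist_eq_norm, sub_sub_cancel_left, norm_neg, norm_mul, Complex.norm_real,
          Complex.norm_I, mul_one, Real.norm_eq_abs, abs_of_pos (by positivity)]
        linarith
      · simp only [Complex.sub_im, Complex.mul_im, Complex.ofReal_re, Complex.I_im, mul_one,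
          Complex.ofReal_im, Complex.I_re, mul_zero, add_zero, heq]
        linarith
  -- Step 2: the crossing point.
  set d : ℝ := a.im - z'.im with hd
  have hdpos : 0 < d := by rw [hd]; linarith
  set M : ℝ := ‖z' - a‖ / d with hM
  have hM0 : 0 ≤ M := div_nonneg (norm_nonneg _) hdpos.le
  set s : ℝ := ρ / (2 * (1 + M)) with hs
  have hspos : 0 < s := by rw [hs]; positivity
  have hsM : s * (1 + M) < ρ := by
    have h1 : s * (1 + M) = ρ / 2 := by rw [hs]; field_simp
    rw [h1]; linarith
  have hsρ : s < ρ := by nlinarith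
  set w : ℂ := a + (s : ℂ) * Complex.I with hw
  have hw_im : w.im = a.im + s := by
    simp [hw, Complex.add_im, Complex.mul_im]
  have hw_sub : w - a = (s : ℂ) * Complex.I := by rw [hw]; ring
  have hw_norm : ‖w - a‖ = s := by
    rw [hw_sub, norm_mul, Complex.norm_real, Complex.norm_I, mul_one, Real.norm_eq_abs, abs_of_pos hspos]
  have hw_mem : w ∈ Ω := by
    have hw' : w ∈ {z : ℂ | a.im < z.im} ∩ ball a ρ := by
      refine ⟨?_, ?_⟩
      · simp only [mem_setOf_eq, hw_im]; linarith
      · rw [Metric.mem_ball, dist_eq_norm, hw_norm]; exact hsρ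
    rw [← hflat] at hw'
    exact hw'.1
  set l : ℝ := s / (s + d) with hl
  have hsd : 0 < s + d := by positivity
  have hl0 : 0 < l := by rw [hl]; positivity
  have hl1 : l < 1 := by rw [hl, div_lt_one hsd]; linarith
  have hld : l ≤ s / d := by
    rw [hl]; exact div_le_div_of_nonneg_left hspos.le hdpos (by linarith)
  -- the convex combination `q = (1 - l) w + l z'`
  set q : ℂ := (1 - l) • w + l • z' with hq
  have hq_mem : q ∈ Ω := hconv hw_mem hz' (by linarith) hl0.le (by ring)
  have hq_eq : q = ((1 - l : ℝ) : ℂ) * w + ((l : ℝ) : ℂ) * z' := by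
    rw [hq, Complex.real_smul, Complex.real_smul]
  have hq_im : q.im = a.im := by
    rw [hq_eq, Complex.add_im, Complex.im_ofReal_mul, Complex.im_ofReal_mul, hw_im]
    have hz'im : z'.im = a.im - d := by rw [hd]; ring
    rw [hz'im, hl]
    field_simp
    ring
  have hq_ball : q ∈ ball a ρ := by
    rw [Metric.mem_ball, dist_eq_norm]
    have hsplit : q - a = ((1 - l : ℝ) : ℂ) * (w - a) + ((l : ℝ) : ℂ) * (z' - a) := by
      rw [hq_eq]; push_cast; ring
    calc ‖q - a‖ = ‖((1 - l : ℝ) : ℂ) * (w - a) + ((l : ℝ) : ℂ) * (z' - a)‖ := by rw [hsplit]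
      _ ≤ ‖((1 - l : ℝ) : ℂ) * (w - a)‖ + ‖((l : ℝ) : ℂ) * (z' - a)‖ := norm_add_le _ _
      _ = (1 - l) * s + l * ‖z' - a‖ := by
          rw [norm_mul, norm_mul, Complex.norm_real, Complex.norm_real, Real.norm_eq_abs,
            Real.norm_eq_abs, abs_of_nonneg (by linarith), abs_of_nonneg hl0.le, hw_norm]
      _ ≤ s + (s / d) * ‖z' - a‖ := by
          have h1 : (1 - l) * s ≤ s := by nlinarith
          have h2 : l * ‖z' - a‖ ≤ (s / d) * ‖z' - a‖ :=
            mul_le_mul_of_nonneg_right hld (norm_nonneg _)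
          linarith
      _ = s * (1 + M) := by rw [hM]; field_simp
      _ < ρ := hsM
  have hq' : q ∈ {z : ℂ | a.im < z.im} ∩ ball a ρ := by
    rw [← hflat]; exact ⟨hq_mem, hq_ball⟩
  have := hq'.1
  simp only [mem_setOf_eq, hq_im, lt_self_iff_false] at this

/-- **A row-`0` up-vertex is a FLOOR vertex**: the up-face `(x, 0)` of a cell with `x₁ = 0` is joined to the
down-face `(x − e₁, 1)`, whose centre has height `−√3/6 < 0`; rescaled by `δ ≥ 0` it lies on or below the real
axis. [folklore] -/
theorem exists_floor_neighbour_of_bottomRow {v : HexVertex} (h2 : v.2 = 0) (h1 : v.1 1 = 0) {δ : ℝ}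
    (hδ : 0 ≤ δ) : ∃ u : HexVertex, hexGraph.Adj v u ∧ ((δ : ℂ) * hexCenter u).im ≤ 0 := by
  obtain ⟨x, k⟩ := v
  simp only at h2 h1
  subst h2
  refine ⟨(![x 0, x 1 - 1], 1), ?_, ?_⟩
  · have hx : x = ![x 0, x 1] := by
      funext i; fin_cases i <;> rfl
    conv_lhs => rw [hx]
    exact hexGraph_adj_dn (x 0) (x 1)
  · rw [Complex.im_ofReal_mul, Literature.Probability.Percolation.hexCenter_im]
    have hs : 0 < Real.sqrt 3 / 2 := by positivity
    have hrow : ((![x 0, x 1 - 1] : Site 2) 1 : ℝ) = -1 := by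
      simp [h1]
    rw [hrow]
    have : ((-1 : ℝ) + (((1 : Fin 2) : ℕ) + 1) / 3) * (Real.sqrt 3 / 2) ≤ 0 := by
      have h13 : ((-1 : ℝ) + (((1 : Fin 2) : ℕ) + 1) / 3) = -1 / 3 := by norm_num
      rw [h13]
      nlinarith
    exact mul_nonpos_of_nonneg_of_nonpos hδ this

/-- Bottom-row endpoint approximations of a domain with both marked points on `ℝ` are floor-vertex endpoint
approximations (the extra clause of floor-ratio's `IsFloorEndpointApprox`). [folklore] -/
theorem floorEndpoints_of_bottomRow {D : DobrushinDomain} {a b : ℝ → HexVertex}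
    (h0 : (D.pt 0).im = 0) (h1 : (D.pt 1).im = 0)
    (hrow : ∀ᶠ δ : ℝ in 𝓝[>] (0 : ℝ), (a δ).2 = 0 ∧ (a δ).1 1 = 0 ∧ (b δ).2 = 0 ∧ (b δ).1 1 = 0) :
    ∀ᶠ δ : ℝ in 𝓝[>] 0,
      (∃ u : HexVertex, hexGraph.Adj (a δ) u ∧ ((δ : ℂ) * hexCenter u).im ≤ (D.pt 0).im) ∧
      (∃ u : HexVertex, hexGraph.Adj (b δ) u ∧ ((δ : ℂ) * hexCenter u).im ≤ (D.pt 1).im) := by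
  have hpos : ∀ᶠ δ : ℝ in 𝓝[>] (0 : ℝ), 0 < δ := eventually_mem_nhdsWithin
  filter_upwards [hrow, hpos] with δ hδ hδpos
  rw [h0, h1]
  exact ⟨exists_floor_neighbour_of_bottomRow hδ.1 hδ.2.1 hδpos.le,
    exists_floor_neighbour_of_bottomRow hδ.2.2.1 hδ.2.2.2 hδpos.le⟩

/-! ## The sibling W2 stubs give the crux modulo the two estimates -/

/-- **Line `source-residue-restriction-pinning`** (registered sub-goal
`stub_observableToSLE_of_sourceResidueExtension_of_estimates`): half-plane arch tightness → uniform injectivity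
modulus → (its W2 stub `stub_domainEndpointUniversality`, verbatim: SLE(8/3) convergence on CONVEX flat-on-`ℝ`
Dobrushin domains with row-`0` endpoints `+ HexTight` ⟹ identification everywhere) → `ObservableToSLE`.  The convex
flat-on-`ℝ` class is a subclass of the floor class (`subset_upper_of_convex_flat`, `floorEndpoints_of_bottomRow`), on
which the landed floor part (p114707) gives convergence from the crux hypotheses.
[cite: DuminilCopinSmirnov2012, Conjecture 1 (arXiv:1007.0575 p. 7)] -/
theorem stub_observableToSLE_of_sourceResidueExtension_of_estimates :
    (∀ ε : ℝ, 0 < ε → ∃ K : ℝ, 0 < K ∧ ∀ (n : ℕ), 1 ≤ n → ∀ (Λ B : Finset HexVertex)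
      (s t : Sym2 HexVertex), s ∈ hexDomainBoundary Λ → t ∈ hexDomainBoundary Λ → s ≠ t →
      dist (hexMidpoint s) (hexMidpoint t) ≤ n → (hexMidpoint t).im = (hexMidpoint s).im →
      (∀ v ∈ Λ, (hexMidpoint s).im < (hexCenter v).im) →
      (∀ v : HexVertex, v ∈ B ↔ ((hexMidpoint s).im < (hexCenter v).im ∧
        dist (hexCenter v) (hexMidpoint s) ≤ 2 * K * n)) →
      (∑ γ : HexMidEdgeSAW Λ s t, if ∃ v ∈ γ.verts, K * n ≤ dist (hexCenter v) (hexMidpoint s)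
        then hexCriticalFugacity ^ γ.length else 0) ≤
      ε * ∑ γ : HexMidEdgeSAW B s t, hexCriticalFugacity ^ γ.length) →
    (∀ (D : DobrushinDomain) (ρ : ℝ) (a b : ℝ → HexVertex),
      (0 < ρ ∧ (D.pt 1).im = (D.pt 0).im ∧ D.carrier ⊆ {z : ℂ | (D.pt 0).im < z.im} ∧
      D.carrier ∩ ball (D.pt 0) ρ = {z : ℂ | (D.pt 0).im < z.im} ∩ ball (D.pt 0) ρ ∧
      D.carrier ∩ ball (D.pt 1) ρ = {z : ℂ | (D.pt 1).im < z.im} ∩ ball (D.pt 1) ρ) →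
      (IsEmbEndpointApprox hexGraph hexCenter D a b ∧ ∀ᶠ δ : ℝ in 𝓝[>] 0,
      (∃ u : HexVertex, hexGraph.Adj (a δ) u ∧ ((δ : ℂ) * hexCenter u).im ≤ (D.pt 0).im) ∧
      (∃ u : HexVertex, hexGraph.Adj (b δ) u ∧ ((δ : ℂ) * hexCenter u).im ≤ (D.pt 1).im)) →
      ∀ ε η : ℝ, 0 < ε → 0 < η → ∃ θ : ℝ, 0 < θ ∧ ∀ᶠ δ : ℝ in 𝓝[>] 0,
        hexSAWLaw D.carrier δ (a δ) (b δ) {γ | γ.curve ∉ CurveClass.modulusClass ε θ} ≤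
          ENNReal.ofReal η) →
    ((∀ (D : DobrushinDomain) (ρ : ℝ) (a b : ℝ → HexVertex),
      Convex ℝ D.carrier → (D.pt 0).im = 0 → (D.pt 1).im = 0 →
      0 < ρ →
      D.carrier ∩ ball (D.pt 0) ρ = {z : ℂ | (D.pt 0).im < z.im} ∩ ball (D.pt 0) ρ →
      D.carrier ∩ ball (D.pt 1) ρ = {z : ℂ | (D.pt 1).im < z.im} ∩ ball (D.pt 1) ρ →
      IsEmbEndpointApprox hexGraph hexCenter D a b →
      (∀ᶠ δ : ℝ in 𝓝[>] (0 : ℝ), (a δ).2 = 0 ∧ (a δ).1 1 = 0 ∧ (b δ).2 = 0 ∧ (b δ).1 1 = 0) →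
      ConvergesInLawToSLE ((8 : ℝ≥0) / 3) D (fun δ (γ : HexDomainSAW D.carrier δ (a δ) (b δ)) => γ.curve)
        (fun δ => hexSAWLaw D.carrier δ (a δ) (b δ))) →
    HexTight →
    ∀ (D : DobrushinDomain) (a b : ℝ → HexVertex), IsEmbEndpointApprox hexGraph hexCenter D a b →
      ∀ μ : Measure (CurveClass ℂ), IsProbabilityMeasure μ →
        IsSubseqLimitLaw (fun δ (γ : HexDomainSAW D.carrier δ (a δ) (b δ)) => γ.curve)
          (fun δ => hexSAWLaw D.carrier δ (a δ) (b δ)) μ →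
        IsSLELaw ((8 : ℝ≥0) / 3) D μ) →
    ObservableToSLE := by
  intro hHPAT hUIM hExt
  refine observableToSLE_iff_identification.mpr ?_
  intro hO hT
  refine hExt ?_ hT
  intro D ρ a b hconv h0 h1 hρ hflat0 hflat1 hab hrow
  refine stub_floorObservableToSLE_of_estimates hHPAT hUIM hO hT D ρ a b
    ⟨hρ, by rw [h0, h1], subset_upper_of_convex_flat D.isOpen hconv hρ hflat0, hflat0, hflat1⟩
    ⟨hab, floorEndpoints_of_bottomRow h0 h1 hrow⟩

/-- **Line `coalescent-arc-restriction`** (registered sub-goal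
`stub_observableToSLE_of_coalescentArcExtension_of_estimates`): half-plane arch tightness → uniform injectivity
modulus → (its W2 stub `stub_extension`, with the line's vocabulary `FlatOnLine`, `BottomRow`, `FlatIdentification`,
`Identification` unfolded: `HexObservableLimit → HexTight →` identification on convex flat-on-`ℝ` domains `C ⊆ ℍ` with
bottom-row endpoints, given tightness, ⟹ identification everywhere) → `ObservableToSLE`.  The `FlatOnLine` class is a
subclass of the floor class (`C ⊆ ℍ` is assumed; `floorEndpoints_of_bottomRow`), on which the landed floor part
(`stub_floorIdentification_of_estimates`, p114707) identifies the subsequential limits.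
[cite: DuminilCopinSmirnov2012, Conjecture 1 (arXiv:1007.0575 p. 7)] -/
theorem stub_observableToSLE_of_coalescentArcExtension_of_estimates :
    (∀ ε : ℝ, 0 < ε → ∃ K : ℝ, 0 < K ∧ ∀ (n : ℕ), 1 ≤ n → ∀ (Λ B : Finset HexVertex)
      (s t : Sym2 HexVertex), s ∈ hexDomainBoundary Λ → t ∈ hexDomainBoundary Λ → s ≠ t →
      dist (hexMidpoint s) (hexMidpoint t) ≤ n → (hexMidpoint t).im = (hexMidpoint s).im →
      (∀ v ∈ Λ, (hexMidpoint s).im < (hexCenter v).im) →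
      (∀ v : HexVertex, v ∈ B ↔ ((hexMidpoint s).im < (hexCenter v).im ∧
        dist (hexCenter v) (hexMidpoint s) ≤ 2 * K * n)) →
      (∑ γ : HexMidEdgeSAW Λ s t, if ∃ v ∈ γ.verts, K * n ≤ dist (hexCenter v) (hexMidpoint s)
        then hexCriticalFugacity ^ γ.length else 0) ≤
      ε * ∑ γ : HexMidEdgeSAW B s t, hexCriticalFugacity ^ γ.length) →
    (∀ (D : DobrushinDomain) (ρ : ℝ) (a b : ℝ → HexVertex),
      (0 < ρ ∧ (D.pt 1).im = (D.pt 0).im ∧ D.carrier ⊆ {z : ℂ | (D.pt 0).im < z.im} ∧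
      D.carrier ∩ ball (D.pt 0) ρ = {z : ℂ | (D.pt 0).im < z.im} ∩ ball (D.pt 0) ρ ∧
      D.carrier ∩ ball (D.pt 1) ρ = {z : ℂ | (D.pt 1).im < z.im} ∩ ball (D.pt 1) ρ) →
      (IsEmbEndpointApprox hexGraph hexCenter D a b ∧ ∀ᶠ δ : ℝ in 𝓝[>] 0,
      (∃ u : HexVertex, hexGraph.Adj (a δ) u ∧ ((δ : ℂ) * hexCenter u).im ≤ (D.pt 0).im) ∧
      (∃ u : HexVertex, hexGraph.Adj (b δ) u ∧ ((δ : ℂ) * hexCenter u).im ≤ (D.pt 1).im)) →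
      ∀ ε η : ℝ, 0 < ε → 0 < η → ∃ θ : ℝ, 0 < θ ∧ ∀ᶠ δ : ℝ in 𝓝[>] 0,
        hexSAWLaw D.carrier δ (a δ) (b δ) {γ | γ.curve ∉ CurveClass.modulusClass ε θ} ≤
          ENNReal.ofReal η) →
    (HexObservableLimit → HexTight →
      (∀ (C : DobrushinDomain) (ρ : ℝ) (a b : ℝ → HexVertex),
        (0 < ρ ∧ C.carrier ⊆ upperHalfPlaneSet ∧
          ∀ i : Fin 2, (C.pt i).im = 0 ∧
            C.carrier ∩ Metric.ball (C.pt i) ρ = upperHalfPlaneSet ∩ Metric.ball (C.pt i) ρ) →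
        Convex ℝ C.carrier →
        IsEmbEndpointApprox hexGraph hexCenter C a b →
        (∀ᶠ δ : ℝ in 𝓝[>] 0, (a δ).2 = 0 ∧ (a δ).1 1 = 0 ∧ (b δ).2 = 0 ∧ (b δ).1 1 = 0) →
        IsTightAlongMesh (fun δ (γ : HexDomainSAW C.carrier δ (a δ) (b δ)) => γ.curve)
          (fun δ => hexSAWLaw C.carrier δ (a δ) (b δ)) →
        ∀ μ : Measure (CurveClass ℂ), IsProbabilityMeasure μ →
          IsSubseqLimitLaw (fun δ (γ : HexDomainSAW C.carrier δ (a δ) (b δ)) => γ.curve)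
            (fun δ => hexSAWLaw C.carrier δ (a δ) (b δ)) μ →
          IsSLELaw ((8 : ℝ≥0) / 3) C μ) →
      ∀ (D : DobrushinDomain) (a b : ℝ → HexVertex), IsEmbEndpointApprox hexGraph hexCenter D a b →
        ∀ μ : Measure (CurveClass ℂ), IsProbabilityMeasure μ →
          IsSubseqLimitLaw (fun δ (γ : HexDomainSAW D.carrier δ (a δ) (b δ)) => γ.curve)
            (fun δ => hexSAWLaw D.carrier δ (a δ) (b δ)) μ →
          IsSLELaw ((8 : ℝ≥0) / 3) D μ) →
    ObservableToSLE := by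
  intro hHPAT hUIM hExt
  refine observableToSLE_iff_identification.mpr ?_
  intro hO hT
  refine hExt hO hT ?_
  intro C ρ a b hflat _hconv hab hrow _htight μ hμ hsub
  obtain ⟨hρ, hsub', hpt⟩ := hflat
  have h0 : (C.pt 0).im = 0 := (hpt 0).1
  have h1 : (C.pt 1).im = 0 := (hpt 1).1
  have hup : ∀ i : Fin 2, {z : ℂ | (C.pt i).im < z.im} = upperHalfPlaneSet := by
    intro i
    ext z
    simp only [mem_setOf_eq, (hpt i).1]
  refine stub_floorIdentification_of_estimates hHPAT hUIM hO C ρ a b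
    ⟨hρ, by rw [h0, h1], ?_, ?_, ?_⟩ ⟨hab, floorEndpoints_of_bottomRow h0 h1 hrow⟩ μ hμ hsub
  · rw [hup 0]; exact hsub'
  · rw [hup 0]; exact (hpt 0).2
  · rw [hup 1]; exact (hpt 1).2

end Summit.CriticalPhenomena.SAWScalingLimit.Theorems.ObservableToSLE.FloorRatio

end
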